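import Literature.MathematicalPhysics.QuantumFieldTheory.U1VillainMasslessPhotonD4Proofs
import HarnessLib

/-!
# The free-boundary infinite-volume Villain `U(1)` state (Garban–Sepúlveda 2023 Prop. 2.11) and
# the clustering consequence of Fröhlich–Spencer's masslessness theorem

Companion of `Literature/MathematicalPhysics/QuantumFieldTheory/U1VillainMasslessPhotonD4.lean`
(the named fact `FrohlichSpencerVillainMasslessPhotonD4`, Fröhlich–Spencer 1982 §2.11: for
Villain `U(1)₄` at large `β` the infinite-volume two-plaquette field-strength function is not
summable) and of its proof companions `VillainKernelAnalysis.lean`,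
`U1VillainMasslessPhotonD4Proofs.lean`.

## Contents

* Named fact `VillainU1FreeInfiniteVolumeLimit d` (Garban–Sepúlveda 2023 Prop. 2.11, after
  Fröhlich–Spencer 1982 §1 footnote 2 / p. 419 and Ginibre 1970): for `β > 0` the free-boundary
  Villain theories on the cubes `Λ_L = {-L,…,L}^d` converge, on bounded continuous cylinder
  observables, to a probability measure `μ_β` on `U(1)` configurations of `ℤ^d` (the
  infinite-volume state `⟨·⟩(β)` in which FS82 §2.11 is formulated).
* PROVED from the two facts:
  `FrohlichSpencerVillainMasslessPhotonD4.exists_state` — for `β > max β₀ 0` the infinite-volume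
  state exists, the two-plaquette function of the fact is `K(x) = ∫ E_{p₀} E_{p₀+x} dμ_β`, the
  one-point functions `∫ E_p dμ_β` vanish, and `K` is neither summable nor exponentially
  decaying; and
  `FrohlichSpencerVillainMasslessPhotonD4.not_uniformClustering` — **the Villain, free-boundary
  analogue of the barrier fact `Literature.Barriers.QuantumFields.AbelianMasslessPhaseD4`, as a
  theorem from printed facts**: for `β > max β₀ 0` the state `μ_β` admits NO rate `m` at which all
  truncated correlations `Cov_{μ_β}(F₁, F₂ ∘ θ_x)` of bounded measurable gauge-invariant local
  observables (`LatticeGaugeDLR` vocabulary: `IsLocalObservable`, `IsZdGaugeInvariant`,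
  `configShift`) decay exponentially (`HasExponentialDecayRate`). Witness `F₁ = F₂ = E_{p₀}`,
  `p₀ = (0; 0, 1)`: `⟨E_p⟩ = 0` (`zdVillainExpect_villainFieldStrength` passes to the limit), so the
  covariance is `K(-x)`; a decay rate would make `K` summable (`HasExponentialDecayRate.summable`),
  contradicting Fröhlich–Spencer.

## What the source prints

Garban–Sepúlveda, *Improved spin-wave estimate for Wilson loops in U(1) lattice gauge theory*,
IMRN 2023 (arXiv:2107.04021v2), Prop. 2.11 (numbered 15 in the held text layer): "Let `β > 0`
and `(θ_j, m_j)` be a Villain `U(1)`-lattice gauge theory in `Λ_j = [-j,j]^n ∩ ℤ^n` with free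
boundary conditions at inverse temperature `β`. Then as `j → ∞`, `(θ_j, m_j)` converges in law
to an infinite-volume `U(1)`-lattice gauge theory on `ℤ^n`." Sketch of proof, ibid.: "As the
conditional law of `m_j` given `θ_j` is local, it is enough to obtain the infinite volume limit
only for the 1-form `θ_j`. This is stated both for the Wilson and Villain interaction in
[Fröhlich–Spencer 1982] as a standard consequence of Ginibre's inequalities ([Ginibre 1970])."
Fröhlich–Spencer 1982, p. 416: "`⟨·⟩(β) = lim_{Λ ↗ ℤ^ν} ⟨·⟩_Λ(β)` … (Some limit always exists by
compactness.)", footnote 2: "In the abelian case, the existence of the limit follows from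
[Ginibre]"; p. 419: "Existence of the limit is a standard consequence of Ginibre's inequalities
(for the models with Wilson's and with Villain action)".

## Design choices and flags

* Transcription of "converges in law" for the `[-π,π)^{E}`-valued edge-angle field: weak
  convergence of every finite-dimensional marginal, i.e. `⟨F⟩_{Λ_L}(β) → ∫ F dμ` for every
  bounded continuous `F` depending on finitely many edges, in the tree's realisation of the
  free-boundary theories on all of `U(1)^{E(ℤ^d)}` (`zdVillainMeasure`, independent Haar variables
  off `Λ`; for a cylinder `F` and `L` large the extra variables are invisible). The boundedness
  clause is redundant given continuity on the compact configuration space but is kept for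
  uniformity with `Sweep1.IsInfiniteVolumeLimit` / `LatticeGaugeDLR.IsInfiniteVolumeLimitAlong`.
* Stated for every `d` (printed for `ℤ^n`, all `n`) and `β > 0` as printed; the proof in the
  source is a sketch deferring to FS82 + Ginibre, so a named fact (not a theorem) is the right
  form; its discharge would need Ginibre's inequality for the Villain weight (positive Fourier
  coefficients) and a density argument.
* Not here: uniqueness / translation invariance of `μ_β`, the DLR property, Dirichlet boundary
  conditions (GS "N.B."), the coupling with the integer 2-form `m`.

## References

* C. Garban, A. Sepúlveda, IMRN 2023 (arXiv:2107.04021v2), Def. 1.1, Prop. 2.11.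
* J. Fröhlich, T. Spencer, Comm. Math. Phys. 83 (1982) 411–454, §1 p. 416 fn. 2, §2.2 p. 419,
  §2.11 pp. 433–434.
* J. Ginibre, Comm. Math. Phys. 16 (1970) 310–328.
-/

noncomputable section

open MeasureTheory Filter Real Set ProbabilityTheory
open scoped Topology ENNReal
open Literature.Probability.LatticeModels Literature.MathematicalPhysics.QuantumLattice

namespace Literature.MathematicalPhysics.QuantumFieldTheory

/-! ### The existence fact -/

/-- **Named fact (existence of the free-boundary infinite-volume Villain state; Garban–Sepúlveda
2023 Prop. 2.11, after Fröhlich–Spencer 1982 §1 footnote 2 / p. 419 and Ginibre 1970).** "Let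
`β > 0` and `(θ_j, m_j)` be a Villain `U(1)`-lattice gauge theory in `Λ_j = [-j,j]^n ∩ ℤ^n` with
free boundary conditions at inverse temperature `β`. Then as `j → ∞`, `(θ_j, m_j)` converges in
law to an infinite-volume `U(1)`-lattice gauge theory on `ℤ^n`" ("a standard consequence of
Ginibre's inequalities", stated in FS82 for the Wilson and Villain interactions). Transcription:
for `β > 0` there is a probability measure `μ` on `U(1)` configurations of `ℤ^d` such that
`⟨F⟩_{Λ_L}(β) → ∫ F dμ` along the cubes `Λ_L = {-L,…,L}^d` (`HasBoxLimit`) for every bounded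
continuous `F` depending on finitely many edges (`zdVillainExpect` = the free-boundary Villain
expectation of `U1VillainMasslessPhotonD4.lean`). See the module docstring for the reading of
"in law" and for what is not transcribed.
[cite: GarbanSepulveda2023, Prop. 2.11 (arXiv v2 §2.3.1), with FrohlichSpencerCMP1982 §1 fn. 2 (p. 416), p. 419, and Ginibre1970] -/
def VillainU1FreeInfiniteVolumeLimit (d : ℕ) : Prop :=
  ∀ β : ℝ, 0 < β → ∃ μ : Measure (ZdGaugeConfig d Circle), IsProbabilityMeasure μ ∧
    ∀ (F : ZdGaugeConfig d Circle → ℝ) (S : Finset (ZdEdge d)),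
      DependsOn F (S : Set (ZdEdge d)) → Continuous F → (∃ C, ∀ U, |F U| ≤ C) →
        HasBoxLimit (fun Λ => zdVillainExpect β Λ F) (∫ U, F U ∂μ)

/-! ### Consequences with the Fröhlich–Spencer fact (proved) -/

/-- The product `E_{(0;i,j)} E_{(x;i,j)}` is a bounded continuous cylinder observable (`β > 0`),
so the existence fact applies to the two-plaquette functions. [folklore] -/
theorem villainFieldCorrObs_regular {d : ℕ} {β : ℝ} (hβ : 0 < β) (i j : Fin d)
    (x : Literature.Probability.LatticeModels.Site d) :
    ∃ S : Finset (ZdEdge d),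
      DependsOn (fun U : ZdGaugeConfig d Circle =>
          villainFieldStrength β (U.plaquette 0 i j) * villainFieldStrength β (U.plaquette x i j))
        (S : Set (ZdEdge d)) ∧
      Continuous (fun U : ZdGaugeConfig d Circle =>
          villainFieldStrength β (U.plaquette 0 i j) * villainFieldStrength β (U.plaquette x i j)) ∧
      ∃ C, ∀ U : ZdGaugeConfig d Circle,
        |villainFieldStrength β (U.plaquette 0 i j) * villainFieldStrength β (U.plaquette x i j)| ≤ C := by
  classical
  obtain ⟨C₁, hC₁⟩ := exists_bound_villainFieldStrength_plaquette (d := d) hβ 0 i j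
  obtain ⟨C₂, hC₂⟩ := exists_bound_villainFieldStrength_plaquette (d := d) hβ x i j
  refine ⟨{((0 : Literature.Probability.LatticeModels.Site d), i), (0 + Pi.single i 1, j),
      (0 + Pi.single j 1, i), ((0 : Literature.Probability.LatticeModels.Site d), j)} ∪
    {(x, i), (x + Pi.single i 1, j), (x + Pi.single j 1, i), (x, j)}, ?_, ?_, ⟨C₁ * C₂, fun U => ?_⟩⟩
  · intro U V hUV
    rw [Finset.coe_union] at hUV
    have h1 := dependsOn_villainFieldStrength_plaquette (d := d) β 0 i j
      (fun e he => hUV e (Or.inl he))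
    have h2 := dependsOn_villainFieldStrength_plaquette (d := d) β x i j
      (fun e he => hUV e (Or.inr he))
    simp only at h1 h2
    simp only [h1, h2]
  · exact (continuous_villainFieldStrength_plaquette hβ 0 i j).mul
      (continuous_villainFieldStrength_plaquette hβ x i j)
  · rw [abs_mul]
    exact mul_le_mul (hC₁ U) (hC₂ U) (abs_nonneg _) ((abs_nonneg _).trans (hC₁ U))

/-- **The two-plaquette function in the infinite-volume state (proved from the two facts).** For
`β > max β₀ 0` there is a probability measure `μ` — the free-boundary infinite-volume Villain
state — such that: `⟨F⟩_{Λ_L}(β) → ∫ F dμ` for bounded continuous cylinder `F`; all one-point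
functions `∫ E_p dμ` vanish (`zdVillainExpect_villainFieldStrength` in the limit); and for every
coordinate plane `i < j` the function `K(x) = ∫ E_{(0;i,j)} E_{(x;i,j)} dμ` is the box limit of
the finite-volume two-plaquette functions and is neither summable nor exponentially decaying. [folklore] -/
theorem FrohlichSpencerVillainMasslessPhotonD4.exists_state
    (h : FrohlichSpencerVillainMasslessPhotonD4) (hlim : VillainU1FreeInfiniteVolumeLimit 4) :
    ∃ β₁ : ℝ, ∀ β : ℝ, β₁ < β →
      ∃ μ : Measure (ZdGaugeConfig 4 Circle), IsProbabilityMeasure μ ∧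
        (∀ (F : ZdGaugeConfig 4 Circle → ℝ) (S : Finset (ZdEdge 4)),
          DependsOn F (S : Set (ZdEdge 4)) → Continuous F → (∃ C, ∀ U, |F U| ≤ C) →
            HasBoxLimit (fun Λ => zdVillainExpect β Λ F) (∫ U, F U ∂μ)) ∧
        (∀ (y : Literature.Probability.LatticeModels.Site 4) (i j : Fin 4),
          ∫ U, villainFieldStrength β (U.plaquette y i j) ∂μ = 0) ∧
        ∀ i j : Fin 4, i < j →
          (∀ x, HasBoxLimit (fun Λ => zdVillainFieldCorr β Λ i j x)
            (∫ U, villainFieldStrength β (U.plaquette 0 i j) *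
              villainFieldStrength β (U.plaquette x i j) ∂μ)) ∧
          ¬ Summable (fun x => ∫ U, villainFieldStrength β (U.plaquette 0 i j) *
              villainFieldStrength β (U.plaquette x i j) ∂μ) ∧
          ¬ HasExponentialDecay (fun x => ∫ U, villainFieldStrength β (U.plaquette 0 i j) *
              villainFieldStrength β (U.plaquette x i j) ∂μ) := by
  obtain ⟨β₀, hβ⟩ := h.not_summable_of_hasBoxLimit
  refine ⟨max β₀ 0, fun β hb => ?_⟩
  have hb1 : β₀ < β := lt_of_le_of_lt (le_max_left _ _) hb
  have hb0 : 0 < β := lt_of_le_of_lt (le_max_right _ _) hb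
  obtain ⟨μ, hμ, hconv⟩ := hlim β hb0
  have hmean : ∀ (y : Literature.Probability.LatticeModels.Site 4) (i j : Fin 4),
      ∫ U, villainFieldStrength β (U.plaquette y i j) ∂μ = 0 := by
    intro y i j
    obtain ⟨Cy, hCy⟩ := exists_bound_villainFieldStrength_plaquette (d := 4) hb0 y i j
    have hl := hconv _ _ (dependsOn_villainFieldStrength_plaquette β y i j)
      (continuous_villainFieldStrength_plaquette hb0 y i j) ⟨Cy, hCy⟩
    have h0 : HasBoxLimit
        (fun Λ => zdVillainExpect β Λ fun U => villainFieldStrength β (U.plaquette y i j)) 0 := by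
      simp only [zdVillainExpect_villainFieldStrength hb0]
      exact tendsto_const_nhds
    exact tendsto_nhds_unique hl h0
  refine ⟨μ, hμ, hconv, hmean, fun i j hij => ?_⟩
  have hK : ∀ x, HasBoxLimit (fun Λ => zdVillainFieldCorr β Λ i j x)
      (∫ U, villainFieldStrength β (U.plaquette 0 i j) *
        villainFieldStrength β (U.plaquette x i j) ∂μ) := by
    intro x
    obtain ⟨S, hS, hc, hbd⟩ := villainFieldCorrObs_regular hb0 i j x
    exact hconv _ S hS hc hbd
  have hns := hβ β hb1 i j hij _ hK
  exact ⟨hK, hns, fun hdec => hns hdec.summable⟩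

/-- Decay rates on `ℤ^d` are invariant under `x ↦ -x`. [folklore] -/
private theorem hasExponentialDecayRate_comp_neg {d : ℕ}
    {G : Literature.Probability.LatticeModels.Site d → ℝ} {m : ℝ}
    (h : HasExponentialDecayRate (fun x => G (-x)) m) : HasExponentialDecayRate G m := by
  obtain ⟨hm, C, hC⟩ := h
  exact ⟨hm, C, fun x => by simpa [norm_neg] using hC (-x)⟩

/-- **Weak-coupling Villain `U(1)₄` admits no uniform exponential clustering rate (proved from
the two printed facts)** — the Villain-action, free-boundary analogue of the clause negated in
`Literature.Barriers.QuantumFields.AbelianMasslessPhaseD4` (there: Wilson action, torus limit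
states, unprinted). Under `FrohlichSpencerVillainMasslessPhotonD4` (FS82 §2.11) and
`VillainU1FreeInfiniteVolumeLimit 4` (GS2023 Prop. 2.11 / Ginibre), for every `β > max β₀ 0` the
infinite-volume state `μ` (a probability measure which IS the cube limit of the finite-volume
theories on bounded continuous cylinder observables) admits NO rate `m` such that
`Cov_μ(F₁, F₂ ∘ θ_x)` decays at rate `m` for all bounded measurable gauge-invariant local
observables `F₁, F₂`. Witness `F₁ = F₂ = E_{p₀}`, `p₀ = (0; 0, 1)`: `⟨E_p⟩_μ = 0`, so the
covariance equals `K(-x)`, `K(y) = ∫ E_{p₀} E_{(y;0,1)} dμ` the two-plaquette function, whose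
decay at rate `m` would make `K` summable (`HasExponentialDecayRate.summable`), contradicting
Fröhlich–Spencer. [folklore] -/
theorem FrohlichSpencerVillainMasslessPhotonD4.not_uniformClustering
    (h : FrohlichSpencerVillainMasslessPhotonD4) (hlim : VillainU1FreeInfiniteVolumeLimit 4) :
    ∃ β₁ : ℝ, ∀ β : ℝ, β₁ < β →
      ∃ μ : Measure (ZdGaugeConfig 4 Circle), IsProbabilityMeasure μ ∧
        (∀ (F : ZdGaugeConfig 4 Circle → ℝ) (S : Finset (ZdEdge 4)),
          DependsOn F (S : Set (ZdEdge 4)) → Continuous F → (∃ C, ∀ U, |F U| ≤ C) →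
            HasBoxLimit (fun Λ => zdVillainExpect β Λ F) (∫ U, F U ∂μ)) ∧
        ¬ ∃ m : ℝ, ∀ F₁ F₂ : ZdGaugeConfig 4 Circle → ℝ,
          Literature.MathematicalPhysics.QuantumLattice.IsLocalObservable F₁ →
          Literature.MathematicalPhysics.QuantumLattice.IsLocalObservable F₂ →
          Measurable F₁ → Measurable F₂ →
          (∃ C, ∀ U, |F₁ U| ≤ C) → (∃ C, ∀ U, |F₂ U| ≤ C) →
          IsZdGaugeInvariant F₁ → IsZdGaugeInvariant F₂ →
            HasExponentialDecayRate
              (fun x : Literature.Probability.LatticeModels.Site 4 =>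
                cov[F₁, fun U => F₂ (configShift x U); μ]) m := by
  obtain ⟨β₀, hβ⟩ := h.not_summable_of_hasBoxLimit
  refine ⟨max β₀ 0, fun β hb => ?_⟩
  have hb1 : β₀ < β := lt_of_le_of_lt (le_max_left _ _) hb
  have hb0 : 0 < β := lt_of_le_of_lt (le_max_right _ _) hb
  obtain ⟨μ, hμ, hconv⟩ := hlim β hb0
  refine ⟨μ, hμ, hconv, ?_⟩
  rintro ⟨m, hm⟩
  -- one-point functions vanish in the limit state
  have hmean : ∀ y : Literature.Probability.LatticeModels.Site 4,
      ∫ U, villainFieldStrength β (U.plaquette y 0 1) ∂μ = 0 := by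
    intro y
    obtain ⟨Cy, hCy⟩ := exists_bound_villainFieldStrength_plaquette (d := 4) hb0 y 0 1
    have hl := hconv _ _ (dependsOn_villainFieldStrength_plaquette β y 0 1)
      (continuous_villainFieldStrength_plaquette hb0 y 0 1) ⟨Cy, hCy⟩
    have h0 : HasBoxLimit
        (fun Λ => zdVillainExpect β Λ fun U => villainFieldStrength β (U.plaquette y 0 1)) 0 := by
      simp only [zdVillainExpect_villainFieldStrength hb0]
      exact tendsto_const_nhds
    exact tendsto_nhds_unique hl h0
  -- the two-plaquette function in the state and its non-summability
  set K : Literature.Probability.LatticeModels.Site 4 → ℝ := fun x =>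
    ∫ U, villainFieldStrength β (U.plaquette 0 0 1) * villainFieldStrength β (U.plaquette x 0 1) ∂μ
    with hKdef
  have hK : ∀ x, HasBoxLimit (fun Λ => zdVillainFieldCorr β Λ 0 1 x) (K x) := by
    intro x
    obtain ⟨S, hS, hc, hbd⟩ := villainFieldCorrObs_regular hb0 (0 : Fin 4) 1 x
    exact hconv _ S hS hc hbd
  have hns : ¬ Summable K := hβ β hb1 0 1 (by decide) K hK
  -- the witness observable `P = E_{p₀}` and its covariance
  set P : ZdGaugeConfig 4 Circle → ℝ := fun U => villainFieldStrength β (U.plaquette 0 0 1)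
    with hP
  obtain ⟨C, hC⟩ := exists_bound_villainFieldStrength_plaquette (d := 4) hb0 0 0 1
  have hPm : Measurable P := measurable_villainFieldStrength_plaquette hb0 0 0 1
  have hdec := hm P P (isLocalObservable_villainFieldStrength_plaquette β 0 0 1)
    (isLocalObservable_villainFieldStrength_plaquette β 0 0 1) hPm hPm ⟨C, hC⟩ ⟨C, hC⟩
    (isZdGaugeInvariant_villainFieldStrength_plaquette β 0 0 1)
    (isZdGaugeInvariant_villainFieldStrength_plaquette β 0 0 1)
  have hcov : ∀ x : Literature.Probability.LatticeModels.Site 4,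
      cov[P, fun U => P (configShift x U); μ] = K (-x) := by
    intro x
    have h2 : (fun U => P (configShift x U)) =
        fun U : ZdGaugeConfig 4 Circle => villainFieldStrength β (ZdGaugeConfig.plaquette U (-x) 0 1) := by
      funext U
      simp only [hP, villainFieldStrength_plaquette_configShift, zero_sub]
    obtain ⟨Cx, hCx⟩ := exists_bound_villainFieldStrength_plaquette (d := 4) hb0 (-x) 0 1
    have hm1 : MemLp P 2 μ := MemLp.of_bound hPm.aestronglyMeasurable C
      (Eventually.of_forall fun U => by rw [Real.norm_eq_abs]; exact hC U)
    have hm2 : MemLp (fun U : ZdGaugeConfig 4 Circle =>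
        villainFieldStrength β (ZdGaugeConfig.plaquette U (-x) 0 1)) 2 μ :=
      MemLp.of_bound (measurable_villainFieldStrength_plaquette hb0 (-x) 0 1).aestronglyMeasurable
        Cx (Eventually.of_forall fun U => by rw [Real.norm_eq_abs]; exact hCx U)
    rw [h2, covariance_eq_sub hm1 hm2, hP, hmean 0, hmean (-x), mul_zero, sub_zero]
    rfl
  have hrate : HasExponentialDecayRate (fun x => K (-x)) m := by
    simpa only [hcov] using hdec
  exact hns (hasExponentialDecayRate_comp_neg hrate).summable

end Literature.MathematicalPhysics.QuantumFieldTheory
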